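import Summits.BirchSwinnertonDyer.Rank1Residual.P2.ShuZhaiThirtySixAdmissible
import Summits.BirchSwinnertonDyer.Rank1Residual.P2.CornerFTwoModelClasses
import Literature.NumberTheory.EllipticCurves.ShuZhai2021.Base144a1
import Literature.NumberTheory.Sieve.PolymathLcmSumsEuler
import HarnessLib

/-!
# Cell `bsd-print-cf2` (D-0131 (2) PRINT TIER, leaf CornerF @ `p = 2`), typer ty2 (discharge
# interface) — the curve `144a1 : y² = x³ − 1` (two-torsion normal form `y² = x³ + 3x² + 3x`) in the
# SETTING of Shu–Zhai 2021 Thm 1.2 / 1.4 / 4.10, every kernel-checkable hypothesis DISCHARGED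

HONEST FRAMING (cell `bsd-print-cf2`, HOME `run/shared/lean/pub/bsd-print-cf2/`, verbatim in every
file): the partition leaf is `CornerF W 2` — `W/ℚ` globally minimal elliptic WITH CM and
`ord_{s=1} L(E,s) = 1`, at the prime `2` (rung leaf `WAllCornerFTwo`; OPEN AS A CLASS). Nothing
class-wide is closed here; no named fact is introduced; nothing is asserted beyond kernel theorems
about ONE explicit curve and its twists. CONTEXT (lit g4, DOSSIER §17): the Shu–Zhai door (J. reine
angew. Math. 775 (2021), Thms 1.2 / 1.4 / 4.10) has a SECOND `j = 0` base in print,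
`E₀ = 144a1 : y² = x³ − 1 = 36a1^{(−1)}` (Cremona 1992 Table 1, N = 144: A1 first of its class; Table 4:
`L(E₀,1)/Ω = 1/2`): BY NAME, `ord_{s=1} L = rank = 1 ∧ Ш odd ∧ BSD(W,2)` on `W⁺_{p,M} : y² = x³ + (pM)³`
(`p ≡ 23 (mod 24)` prime, `M = 1` or a product of distinct primes `q ≡ 5 (mod 12)` with `M ≡ 1 (mod 24)`)
— members of crux stmt-BirchSwinnertonDyer-20671 `InertJZeroOfFacts` (aside 21260
`InertShuZhaiOneFortyFourOfFactsPlus`), complementary in sign to the CLOSED `36a1` family (aside 20597).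
The base curve and the table fact `ShuZhai2021.base144a1_optimal_cuspZero` are the literature seat's
`ShuZhai2021/Base144a1.lean` (p551268); THIS FILE discharges, in the kernel, every OTHER hypothesis of
the typed theorems at `E₀`, word for word on prover p3's `P2/ShuZhaiThirtySixCurve.lean` +
`P2/ShuZhaiThirtySixAdmissible.lean` (base `36a1 = ⟨0,−3,0,3,0⟩`; here `⟨0,3,0,3,0⟩` — the SAME
discriminants `−432`, `6912`, hence the SAME fields `ℚ(√−3)`, `ℚ(√3)` and the SAME congruences, so the
number theory is TRANSPORTED from p3's theorems rather than re-derived):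

* §1 `E₀′ = E₀/E₀[2](ℚ) = (y² = x³ − 6x² − 3x)` (`twoIsogenyCodomain_curve144a1`; `≅ 144a2`) and the
  degree-`2` isogeny (`exists_isogeny_curve144a1_degree_two`);
* §2 (Tor) `#E₀(ℚ)[2] = 2 = #E₀′(ℚ)[2]` (reduction mod `5`: `x² + 3x + 3`, `x² − 6x − 3` have no root mod 5);
* §3 `N(E₀) ∣ 432 = 2⁴·3³` (`conductorNorm_curve144a1_dvd`; Cremona: `N = 144`, not needed);
* §4 the Heegner hypothesis for `N` and hypothesis (ii) of Thm 1.4 for `2N` at `K = ℚ(√−p)`,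
  `p ≡ 23 (mod 24)` (p3's `satisfiesHeegnerHypothesis_two_pow_mul_three_pow`);
* §5 `thm12Setting_curve144a1 Dt hopt hcusp hp h24 hQ`;
* §6 Manin-odd by name (ARS06, `N ≤ 130000`); §6b admissibility of every prime `q ≡ 5 (mod 12)`
  (`isAdmissible_curve144a1`, transported from p3's `isAdmissible_curve36a1`) and the `ℚ(√M)`-condition
  for `M = ∏ q ≡ 1 (mod 24)` (`allPrimesSplitInSqrt_two_mul_conductorNorm_prod_curve144a1`);
* §7 the twists: `E₀^{(D)} = (y² = x³ + 3Dx² + 3D²x) ≅ (y² = x³ − D³)` (`quadraticTwist_curve144a1`,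
  `smul_quadraticTwist_curve144a1`; `D = −pM` gives `y² = x³ + (pM)³`), their CM / INERT-at-`2` type and
  the leaf predicate for their analytic-rank-one minimal models (`cornerF_two_of_smul_twist_curve144a1`).

What remains for the SLICE (pattern: p3's `ShuZhaiThirtySixSlices` / `…IsogenyClass` /
`WAll/TargetCMTwoInertShuZhaiThirtySix`, closer of aside 21260): displays `hSZ12`/`hSZ14`, `hARS`,
`hbase : base144a1_optimal_cuspZero`, `BSD(E₀,2)` for the rank-zero CM base (`hBF`), Cassels for the
isogeny-class MEMBER. Beyond-print: NO (typed interface of printed hypotheses).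

References: [ShuZhai2021] §1 (Thm 1.2, Def 1.1, (Tor), Thm 1.4), Thm 4.10 (arXiv:2102.11808 pp. 3, 13);
[Cremona1997] Table 1 (N = 144, class A) and Table 4 (144A); [SilvermanAEC2009] III.4 Ex 4.5, VII.1 Rem
1.1, VII.3.1(b), X.5 Prop 5.4; [Silverman1994] IV.11.1; [AgasheRibetStein2006] Thm 2.6; [Marcus1977]
Ch. 2 Thm 1, Ch. 3 Thm 25; [Cox2013] §1 Lemma 1.14, §5.B Prop 5.16; HOME/DOSSIER.md §17 (lit g4).
-/

noncomputable section

open scoped Classical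

open WeierstrassCurve NumberField Literature.NumberTheory.EllipticCurves
  Literature.NumberTheory.EllipticCurves.Rank1Residual
  Literature.NumberTheory.EllipticCurves.ModularForms
  Literature.NumberTheory.EllipticCurves.ShuZhai2021
  Summit.BirchSwinnertonDyer.Rank1Residual
  Summit.BirchSwinnertonDyer.BirchSwinnertonDyer.Theorems.ConductorBoundOfBadPrimes

set_option autoImplicit false

namespace Summit.BirchSwinnertonDyer.Rank1Residual.P2

open Literature.NumberTheory.EllipticCurves.ShuZhai2021

attribute [instance] isElliptic_curve144a1 isGloballyMinimal_curve144a1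

/-! ## §1 `E₀ = 144a1 = ⟨0,3,0,3,0⟩` and its `2`-isogenous curve `E₀′ = y² = x³ − 6x² − 3x` -/

/-- The integer equation of `E₀` base-changes to `E₀`. [folklore] -/
theorem curve144a1Int_map :
    (⟨0, 3, 0, 3, 0⟩ : WeierstrassCurve ℤ).map (Int.castRingHom ℚ) = curve144a1 := by
  ext <;> simp [curve144a1, WeierstrassCurve.map]

/-- **`E₀′ = E₀/E₀[2](ℚ) = (y² = x³ − 6x² − 3x)`** (Silverman III.4.5: `Y² = X³ − 2aX² + (a² − 4b)X` for
`a = 3`, `b = 3`); `≅ 144a2 = [0,0,0,−15,−22]` by `x ↦ x + 2`; `ℚ(E₀′[2]) = ℚ(√48) = ℚ(√3)`.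
[cite: SilvermanAEC2009, III.4 Example 4.5] [cite: Cremona1997, Table 1 (class 144a)] -/
theorem twoIsogenyCodomain_curve144a1 :
    curve144a1.twoIsogenyCodomain = (⟨0, -6, 0, -3, 0⟩ : WeierstrassCurve ℚ) := by
  ext <;> norm_num [WeierstrassCurve.twoIsogenyCodomain, curve144a1]

/-- The integer equation of `E₀′` base-changes to `E₀′`. [folklore] -/
theorem curve144a1'Int_map :
    (⟨0, -6, 0, -3, 0⟩ : WeierstrassCurve ℤ).map (Int.castRingHom ℚ) =
      (⟨0, -6, 0, -3, 0⟩ : WeierstrassCurve ℚ) := by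
  ext <;> simp [WeierstrassCurve.map]

/-- `Δ(E₀′) = 6912 = 2⁸·3³ = 3·48²` (the same as for `36a1′`). [folklore] -/
theorem curve144a1'_Δ : (⟨0, -6, 0, -3, 0⟩ : WeierstrassCurve ℚ).Δ = 6912 := by
  simp only [WeierstrassCurve.Δ, WeierstrassCurve.b₂, WeierstrassCurve.b₄, WeierstrassCurve.b₆,
    WeierstrassCurve.b₈]
  norm_num

/-- `E₀′` is elliptic (`Δ = 6912 ≠ 0`). [folklore] -/
theorem isElliptic_curve144a1' : (⟨0, -6, 0, -3, 0⟩ : WeierstrassCurve ℚ).IsElliptic :=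
  ⟨by rw [curve144a1'_Δ]; exact isUnit_iff_ne_zero.mpr (by norm_num)⟩

/-- **`E₀` has CM (`j = 0`, `ℤ[ζ₃]`) and `2` is INERT in its CM field `ℚ(√−3)`** — `E₀` and all its twists
lie in the inert type of the leaf (crux 20363 → child 20671 `InertJZeroOfFacts`).
[cite: SilvermanATAEC1994, App. A §3] -/
theorem hasCM_and_cmInert_two_curve144a1 : curve144a1.HasCM ∧ CMInert curve144a1 2 :=
  ⟨hasCM_curve144a1, cmInert_two_curve144a1⟩

/-- **A rational `2`-isogeny `E₀ → E₀′` of degree `2`** (the tree's PROVED `twoIsogeny`, kernel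
`{O, (0,0)}`). [cite: SilvermanAEC2009, III.4 Example 4.5] -/
theorem exists_isogeny_curve144a1_degree_two :
    ∃ φ : Isogeny curve144a1 (⟨0, -6, 0, -3, 0⟩ : WeierstrassCurve ℚ), φ.degree = 2 := by
  haveI : curve144a1.IsTwoTorsionNF := ⟨rfl, rfl, rfl⟩
  rw [← twoIsogenyCodomain_curve144a1]
  exact ⟨curve144a1.twoIsogeny, degree_twoIsogeny curve144a1⟩

/-! ## §2 (Tor): `#E₀(ℚ)[2] = 2 = #E₀′(ℚ)[2]`, by reduction modulo `5` -/

/-- In a group whose `2`-torsion is `{0, T}` with `T ≠ 0`, `2•T = 0`, the `2`-torsion subtype has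
exactly two elements. [folklore] -/
private theorem natCard_twoTorsion_eq_two_of_subset' {A : Type*} [AddCommGroup A] {T : A} (hT0 : T ≠ 0)
    (hT2 : (2 : ℕ) • T = 0) (h : ∀ τ : A, (2 : ℤ) • τ = 0 → τ = 0 ∨ τ = T) :
    Nat.card {P : A // (2 : ℕ) • P = 0} = 2 := by
  rw [Nat.card_eq_two_iff]
  refine ⟨⟨0, smul_zero _⟩, ⟨T, hT2⟩, fun he => hT0 (Subtype.mk.inj he).symm, ?_⟩
  ext ⟨τ, hτ⟩
  simp only [Set.mem_insert_iff, Set.mem_singleton_iff, Set.mem_univ, iff_true]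
  have hτ' : (2 : ℤ) • τ = 0 := by rw [← natCast_zsmul] at hτ; exact_mod_cast hτ
  rcases h τ hτ' with rfl | rfl
  · exact Or.inl rfl
  · exact Or.inr rfl

/-- **(Tor) for `E₀`: `#E₀(ℚ)[2] = 2`** — `E₀(ℚ)[2] = {O, (0,0)}`: modulo the good odd prime `5` the only
affine `2`-torsion point of `Ẽ₀(𝔽₅)` is `(0,0)` (`x² + 3x + 3` has discriminant `−3`, no root mod `5`), and
prime-to-`5` torsion injects (tree `Rank2Observatory.twoTorsion_eq_zero_or_eq`).
[cite: ShuZhai2021, §1 condition (Tor) (arXiv:2102.11808 p. 3)] [cite: SilvermanAEC2009, Prop. VII.3.1(b)] -/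
theorem natCard_twoTorsion_curve144a1 :
    Nat.card {P : curve144a1.toAffine.Point // (2 : ℕ) • P = 0} = 2 := by
  rw [← curve144a1Int_map]
  haveI : Fact (Nat.Prime 5) := ⟨by norm_num⟩
  set V : WeierstrassCurve ℤ := ⟨0, 3, 0, 3, 0⟩ with hV
  have hT : (0 : ℤ) ^ 2 + V.a₁ * 0 * 0 + V.a₃ * 0 = 0 ^ 3 + V.a₂ * 0 ^ 2 + V.a₄ * 0 + V.a₆ := by
    simp [hV]
  have hT2 : 2 * (0 : ℤ) + V.a₁ * 0 + V.a₃ = 0 := by simp [hV]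
  have hΔ : ¬ ((5 : ℕ) : ℤ) ∣ V.Δ := by
    simp only [hV, WeierstrassCurve.Δ, WeierstrassCurve.b₂, WeierstrassCurve.b₄,
      WeierstrassCurve.b₆, WeierstrassCurve.b₈]
    norm_num
  have hB : BirchSwinnertonDyer.Rank2Observatory.twoTorsionOnlyB V 5 0 0 = true := by
    rw [hV]; decide +kernel
  have h := BirchSwinnertonDyer.Rank2Observatory.twoTorsion_eq_zero_or_eq V hT hT2 5 hΔ
    (by norm_num) hB
  haveI := BirchSwinnertonDyer.Rank2Observatory.isElliptic_rat V
    (BirchSwinnertonDyer.Rank2Observatory.Δ_ne_zero_of_not_dvd V hΔ)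
  refine natCard_twoTorsion_eq_two_of_subset' (Affine.Point.some_ne_zero _) ?_ h
  exact BirchSwinnertonDyer.Rank2Observatory.two_nsmul_some_eq_zero V
    (BirchSwinnertonDyer.Rank2Observatory.Δ_ne_zero_of_not_dvd V hΔ) hT hT2

/-- **(Tor) for `E₀′`: `#E₀′(ℚ)[2] = 2`** — `E₀′(ℚ)[2] = {O, (0,0)}` (`x² − 6x − 3` has discriminant
`48`, no root mod `5`). [cite: ShuZhai2021, §1 condition (Tor) (arXiv:2102.11808 p. 3)]
[cite: SilvermanAEC2009, Prop. VII.3.1(b)] -/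
theorem natCard_twoTorsion_curve144a1' :
    Nat.card {P : (⟨0, -6, 0, -3, 0⟩ : WeierstrassCurve ℚ).toAffine.Point // (2 : ℕ) • P = 0} = 2 := by
  rw [← curve144a1'Int_map]
  haveI : Fact (Nat.Prime 5) := ⟨by norm_num⟩
  set V : WeierstrassCurve ℤ := ⟨0, -6, 0, -3, 0⟩ with hV
  have hT : (0 : ℤ) ^ 2 + V.a₁ * 0 * 0 + V.a₃ * 0 = 0 ^ 3 + V.a₂ * 0 ^ 2 + V.a₄ * 0 + V.a₆ := by
    simp [hV]
  have hT2 : 2 * (0 : ℤ) + V.a₁ * 0 + V.a₃ = 0 := by simp [hV]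
  have hΔ : ¬ ((5 : ℕ) : ℤ) ∣ V.Δ := by
    simp only [hV, WeierstrassCurve.Δ, WeierstrassCurve.b₂, WeierstrassCurve.b₄,
      WeierstrassCurve.b₆, WeierstrassCurve.b₈]
    norm_num
  have hB : BirchSwinnertonDyer.Rank2Observatory.twoTorsionOnlyB V 5 0 0 = true := by
    rw [hV]; decide +kernel
  have h := BirchSwinnertonDyer.Rank2Observatory.twoTorsion_eq_zero_or_eq V hT hT2 5 hΔ
    (by norm_num) hB
  haveI := BirchSwinnertonDyer.Rank2Observatory.isElliptic_rat V
    (BirchSwinnertonDyer.Rank2Observatory.Δ_ne_zero_of_not_dvd V hΔ)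
  refine natCard_twoTorsion_eq_two_of_subset' (Affine.Point.some_ne_zero _) ?_ h
  exact BirchSwinnertonDyer.Rank2Observatory.two_nsmul_some_eq_zero V
    (BirchSwinnertonDyer.Rank2Observatory.Δ_ne_zero_of_not_dvd V hΔ) hT hT2

/-! ## §3 The conductor: `N(E₀) ∣ 432 = 2⁴·3³` (kernel; Cremona: `N = 144`, not needed) -/

/-- **`N(E₀) ∣ 432 = 2⁴·3³` — IN THE KERNEL** (Ogg's `f_q ≤ ord_q Δ_min` at `q = 2, 3`, the only bad
primes; `Δ_min = −432`). [cite: Silverman1994, IV.11.1] [cite: Cremona1997, Table 1 (144a1)] -/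
theorem conductorNorm_curve144a1_dvd : curve144a1.conductorNorm ℤ ∣ 432 :=
  conductorNorm_dvd_of_localBounds 0 3 0 3 0 curve144a1 rfl [(2, 4), (3, 3)]
    (by intro t ht; simp only [List.mem_cons, List.not_mem_nil, or_false] at ht; rcases ht with rfl | rfl <;> norm_num)
    (by decide +kernel) (by norm_num) (by decide +kernel)

/-- `N(E₀) ≠ 0` (instance used by the parametrisation datum at level `N`). [folklore] -/
instance neZero_conductorNorm_curve144a1 : NeZero (curve144a1.conductorNorm ℤ) :=
  ⟨(curve144a1.conductorNorm_pos_holds).ne'⟩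

/-- `2N(E₀) ∣ 864 = 2⁵·3³`. [folklore] -/
theorem two_mul_conductorNorm_curve144a1_dvd : 2 * curve144a1.conductorNorm ℤ ∣ 2 ^ 5 * 3 ^ 3 :=
  (mul_dvd_mul_left 2 conductorNorm_curve144a1_dvd).trans (by norm_num)

/-! ## §4 `K = ℚ(√−p)`, `p ≡ 23 (mod 24)`: `2` and `3` split — the Heegner hypothesis of Thm 1.2 and
hypothesis (ii) of Thm 1.4 at `K` -/

/-- **The Heegner hypothesis of Thm 1.2 for `(144a1, ℚ(√−p))`, `p ≡ 23 (mod 24)`: every prime of `N`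
splits in `ℚ(√−p)`** (`N ∣ 2⁴·3³`; `d = −p ≡ 1 (mod 8)`, `(−p/3) = 1` — p3's
`satisfiesHeegnerHypothesis_two_pow_mul_three_pow`). [cite: ShuZhai2021, Thm. 1.2 hypothesis (arXiv:2102.11808 p. 3)] -/
theorem allPrimesSplitInSqrt_conductorNorm_curve144a1 {p : ℕ} (hp : p.Prime) (h24 : p % 24 = 23) :
    AllPrimesSplitInSqrt (curve144a1.conductorNorm ℤ) (-(p : ℤ)) := by
  refine Or.inr fun F _ _ h2 ⟨x, hx⟩ => ?_
  exact (satisfiesHeegnerHypothesis_two_pow_mul_three_pow h2 hp h24 hx 4 3).of_dvd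
    (conductorNorm_curve144a1_dvd.trans (by norm_num))

/-- **Hypothesis (ii) of Thm 1.4 at `K`: every prime of `2N` splits in `ℚ(√−p)`**, `p ≡ 23 (mod 24)`
(`2N ∣ 2⁵·3³`); Thm 4.10's "`p ≡ −1 (mod 8)`" is implied. [cite: ShuZhai2021, Thm. 1.4 (ii) and Thm. 4.10] -/
theorem allPrimesSplitInSqrt_two_mul_conductorNorm_curve144a1 {p : ℕ} (hp : p.Prime)
    (h24 : p % 24 = 23) : AllPrimesSplitInSqrt (2 * curve144a1.conductorNorm ℤ) (-(p : ℤ)) := by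
  refine Or.inr fun F _ _ h2 ⟨x, hx⟩ => ?_
  exact (satisfiesHeegnerHypothesis_two_pow_mul_three_pow h2 hp h24 hx 5 3).of_dvd
    two_mul_conductorNorm_curve144a1_dvd

/-! ## §5 The setting of Shu–Zhai Thm 1.2 at `E₀ = 144a1` -/

/-- **The setting of Thm 1.2 for `E₀ = 144a1`, `K = ℚ(√−p)` (`p ≡ 23 (mod 24)` prime), `Q` admissible.**
Discharged in the kernel: the degree-`2` isogeny `E₀ → E₀′`, (Tor) for `E₀` and `E₀′`, `p > 3`,
`p ≡ 3 (mod 4)`, the Heegner hypothesis for `N`. Kept as printed (display hypotheses on the optimal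
parametrisation `X₀(144) → E₀` = the content of the table fact `ShuZhai2021.base144a1_optimal_cuspZero`,
lit g4 DOSSIER §17.1): `IsOptimalDatum`, `f([0]) ∉ 2E₀(ℚ)`; and the admissibility of the primes of `Q`
(§6b: every prime `q ≡ 5 (mod 12)`). [cite: ShuZhai2021, Thm. 1.2 (arXiv:2102.11808 p. 3)]
[cite: Cremona1997, Table 1 (144a1) and Table 4 (144A)] -/
theorem thm12Setting_curve144a1 (Dt : ModularParametrizationData curve144a1 (curve144a1.conductorNorm ℤ))
    (hopt : IsOptimalDatum curve144a1 Dt) (hcusp : CuspZeroNotInTwice curve144a1 Dt)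
    {p : ℕ} (hp : p.Prime) (h24 : p % 24 = 23) {Q : Finset ℕ}
    (hQ : ∀ q ∈ Q, IsAdmissible curve144a1 (⟨0, -6, 0, -3, 0⟩ : WeierstrassCurve ℚ) q ∧ q ≠ p) :
    Thm12Setting curve144a1 Dt (⟨0, -6, 0, -3, 0⟩ : WeierstrassCurve ℚ) p Q :=
  ⟨exists_isogeny_curve144a1_degree_two, hopt, hcusp, natCard_twoTorsion_curve144a1,
    natCard_twoTorsion_curve144a1', hp, by omega, by omega,
    allPrimesSplitInSqrt_conductorNorm_curve144a1 hp h24, hQ⟩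

/-! ## §6 The Manin constant of `144a1` is odd — BY NAME (Agashe–Ribet–Stein 2006 Thm 2.6 = Cremona) -/

/-- **Hypothesis (i) of Thm 1.4 ("the Manin constant of `E` is odd") for `144a1`, BY NAME**
(Agashe–Ribet–Stein 2006 Thm 2.6 / Cremona: `c_E = 1` for optimal curves of conductor `≤ 130000`;
`N(E₀) ∣ 432`). [cite: AgasheRibetStein2006, Thm. 2.6 (p. 619)] -/
theorem not_two_dvd_c_of_isOptimalDatum_curve144a1
    (hARS : AgasheRibetStein2006.cremona_abs_maninConstant_eq_one_of_level_le)
    (Dt : ModularParametrizationData curve144a1 (curve144a1.conductorNorm ℤ))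
    (hopt : IsOptimalDatum curve144a1 Dt) : ¬ (2 : ℤ) ∣ Dt.c := by
  have hN : curve144a1.conductorNorm ℤ ≤ 130000 :=
    (Nat.le_of_dvd (by norm_num) conductorNorm_curve144a1_dvd).trans (by norm_num)
  have h1 : |Dt.c| = 1 := hARS curve144a1 Dt hopt hN
  intro h2
  have h3 : (2 : ℤ) ∣ 1 := h1 ▸ (dvd_abs _ _).mpr h2
  omega

/-! ## §6b The admissible primes of `144a1` (Def 1.1): every prime `q ≡ 5 (mod 12)` — TRANSPORTED
from p3's `isAdmissible_curve36a1` (same discriminants, same fields `ℚ(√−3)`, `ℚ(√3)`); and the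
`ℚ(√M)`-condition of Thm 1.4 (ii) for `M = ∏ q ≡ 1 (mod 24)` -/

/-- **Every prime `q ≡ 5 (mod 12)` is ADMISSIBLE for `144a1`** (Def 1.1: `(q, 2N) = 1`, `q` inert in
`ℚ(E₀[2]) = ℚ(√Δ_{E₀}) = ℚ(√−3)` and in `ℚ(E₀′[2]) = ℚ(√Δ_{E₀′}) = ℚ(√3)`): `Δ(144a1) = Δ(36a1) = −432`
and `Δ(E₀′) = Δ(36a1′) = 6912`, so the two inertness clauses ARE p3's (`isAdmissible_curve36a1`), and
`(q, 2N) = 1` since `2N ∣ 2⁵·3³`, `q ≠ 2, 3`. [cite: ShuZhai2021, Def. 1.1 and §5.2 Table]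
[cite: Cox2013, §5.B Prop. 5.16] -/
theorem isAdmissible_curve144a1 {q : ℕ} (hq : q.Prime) (h12 : q % 12 = 5) :
    IsAdmissible curve144a1 (⟨0, -6, 0, -3, 0⟩ : WeierstrassCurve ℚ) q := by
  have hq2 : q ≠ 2 := by rintro rfl; norm_num at h12
  have hq3 : q ≠ 3 := by rintro rfl; norm_num at h12
  obtain ⟨-, -, hE, hE'⟩ := isAdmissible_curve36a1 hq h12
  refine ⟨hq, ?_, ?_, ?_⟩
  · have h864 : Nat.Coprime q (2 ^ 5 * 3 ^ 3) :=
      Nat.Coprime.mul_right (((Nat.coprime_primes hq Nat.prime_two).mpr hq2).pow_right 5)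
        (((Nat.coprime_primes hq Nat.prime_three).mpr hq3).pow_right 3)
    exact h864.coprime_dvd_right two_mul_conductorNorm_curve144a1_dvd
  · rw [curve144a1_Δ, ← curve36a1_Δ]; exact hE
  · rw [curve144a1'_Δ, ← curve36a1'_Δ]; exact hE'

/-- The `Q`-clause of the setting of Thm 1.2 at `144a1` for a finite set of primes `q ≡ 5 (mod 12)` and
`p ≡ 23 (mod 24)` (so `q ≠ p`). [cite: ShuZhai2021, Thm. 1.2 and Def. 1.1] -/
theorem admissible_curve144a1_of_forall_mod_twelve {p : ℕ} (h24 : p % 24 = 23) {Q : Finset ℕ}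
    (hQ : ∀ q ∈ Q, q.Prime ∧ q % 12 = 5) :
    ∀ q ∈ Q, IsAdmissible curve144a1 (⟨0, -6, 0, -3, 0⟩ : WeierstrassCurve ℚ) q ∧ q ≠ p :=
  fun q hq => ⟨isAdmissible_curve144a1 (hQ q hq).1 (hQ q hq).2, by
    have h5 := (hQ q hq).2
    rintro rfl
    omega⟩

/-- **Hypothesis (ii) of Thm 1.4 at `ℚ(√M)`: every prime of `2N` splits in `ℚ(√M)`** for
`M = ∏_{q∈Q} q*` with `Q` a finite set of primes `q ≡ 5 (mod 12)` and `M ≡ 1 (mod 24)` (for `Q = ∅`,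
`M = 1`, empty condition): `d_{ℚ(√M)} = M ≡ 1 (mod 8)` and `(M/3) = 1` — p3's argument for `36a1`
verbatim (`2N ∣ 2⁵·3³` again). [cite: ShuZhai2021, Thm. 1.4 (ii) and Thm. 4.10] [cite: Marcus1977, Ch. 3 Thm. 25] -/
theorem allPrimesSplitInSqrt_two_mul_conductorNorm_prod_curve144a1 {Q : Finset ℕ}
    (hQ : ∀ q ∈ Q, q.Prime ∧ q % 12 = 5) (hM : (∏ q ∈ Q, q) % 24 = 1) :
    AllPrimesSplitInSqrt (2 * curve144a1.conductorNorm ℤ) (∏ q ∈ Q, qStar q) := by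
  rw [prod_qStar_eq_of_forall_mod_twelve hQ]
  set M : ℕ := ∏ q ∈ Q, q with hMdef
  by_cases hM1 : M = 1
  · exact Or.inl ⟨1, by rw [hM1]; norm_num⟩
  refine Or.inr fun F _ _ h2 ⟨y, hy⟩ => ?_
  have hsq : Squarefree M :=
    Literature.NumberTheory.Sieve.LcmEuler.squarefree_prod_of_primes fun q hq => (hQ q hq).1
  have hyM : y ^ 2 = (M : F) := by rw [hy]; push_cast; rfl
  have hD := discr_eq_of_sq_eq_of_squarefree h2 hsq hM1 (by omega) hyM
  have h864 : SatisfiesHeegnerHypothesis (2 ^ 5 * 3 ^ 3) F := by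
    rw [satisfiesHeegnerHypothesis_iff_kronecker _ F h2, hD]
    intro ℓ hℓ hℓN
    rcases (Nat.Prime.dvd_mul hℓ).mp hℓN with h | h
    · obtain rfl := (Nat.prime_dvd_prime_iff_eq hℓ Nat.prime_two).mp (hℓ.dvd_of_dvd_pow h)
      exact ⟨fun _ => by omega, fun h2' => absurd rfl h2'⟩
    · obtain rfl := (Nat.prime_dvd_prime_iff_eq hℓ Nat.prime_three).mp (hℓ.dvd_of_dvd_pow h)
      refine ⟨fun h => absurd h (by norm_num), fun _ => ?_⟩
      have hmod : (M : ℤ) % ((3 : ℕ) : ℤ) = 1 % ((3 : ℕ) : ℤ) := by push_cast; omega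
      rw [jacobiSym.mod_left, hmod, ← jacobiSym.mod_left, jacobiSym.one_left]
  exact h864.of_dvd two_mul_conductorNorm_curve144a1_dvd

/-! ## §7 The twists: `E₀^{(D)} ≅ (y² = x³ − D³)`; the members `W⁺_{p,M} = E₀^{(−pM)} : y² = x³ + (pM)³` -/

/-- **`E₀^{(D)} : y² = x³ + 3Dx² + 3D²x` on the nose** (tree `quadraticTwist`: `b₂ = 12`, `b₄ = 6`,
`b₆ = 0`). [cite: SilvermanAEC2009, X.5 Prop. 5.4 (iii)] -/
theorem quadraticTwist_curve144a1 (D : ℚ) :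
    curve144a1.quadraticTwist D = (⟨0, 3 * D, 0, 3 * D ^ 2, 0⟩ : WeierstrassCurve ℚ) := by
  ext <;> simp [WeierstrassCurve.quadraticTwist, curve144a1, WeierstrassCurve.b₂,
    WeierstrassCurve.b₄, WeierstrassCurve.b₆] <;> ring

/-- **`E₀^{(D)} ≅ (y² = x³ − D³)`** by the shift `x ↦ x − D` (`u = 1`, `r = −D`): `D = −pM` gives the
printed member `y² = x³ + (pM)³` of DOSSIER §17. [cite: SilvermanAEC2009, X.5 Prop. 5.4 (iii)] -/
theorem smul_quadraticTwist_curve144a1 (D : ℚ) :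
    (⟨1, -D, 0, 0⟩ : VariableChange ℚ) • curve144a1.quadraticTwist D =
      (⟨0, 0, 0, 0, -D ^ 3⟩ : WeierstrassCurve ℚ) := by
  rw [quadraticTwist_curve144a1]
  ext <;> simp only [variableChange_a₁, variableChange_a₂, variableChange_a₃, variableChange_a₄,
    variableChange_a₆, inv_one, Units.val_one] <;> ring

/-- **Every model of a twist of `144a1` has CM with `2` INERT in the CM field** (`j = 0`): the Shu–Zhai
family at `144a1` lies in the inert type of the leaf — crux 20363, child 20671 (`InertJZeroOfFacts`);
by file 7 of the atlas its reduced sextic parameter decides the INERT-GOOD / INERT-BAD cell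
(`Atlas.good_two_iff_of_smul_sextic`). [cite: SilvermanAEC2009, X.5 Prop. 5.4 (iii)] -/
theorem hasCM_and_cmInert_two_of_smul_twist_curve144a1 {D : ℚ} (hD : D ≠ 0)
    {W : WeierstrassCurve ℚ} [W.IsElliptic] {C : VariableChange ℚ}
    (hC : C • curve144a1.quadraticTwist D = W) : W.HasCM ∧ CMInert W 2 := by
  have h : (C * (⟨1, -D, 0, 0⟩ : VariableChange ℚ)⁻¹) • (⟨0, 0, 0, 0, -D ^ 3⟩ : WeierstrassCurve ℚ) = W := by
    rw [mul_smul, ← smul_quadraticTwist_curve144a1, inv_smul_smul, hC]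
  exact CornerFTwo.hasCM_and_cmInert_two_of_smul_sextic (neg_ne_zero.mpr (pow_ne_zero 3 hD)) h

/-- **The leaf predicate on the family**: a globally minimal model `W` of a twist of `144a1` with
`ord_{s=1} L(W,s) = 1` satisfies `CornerF W 2` — PARTITION currency: slice INERT of rung W-ALL/12.K12-2.
[cite: SilvermanATAEC1994, App. A §3] -/
theorem cornerF_two_of_smul_twist_curve144a1 {D : ℚ} (hD : D ≠ 0)
    {W : WeierstrassCurve ℚ} [W.IsElliptic] [W.IsGloballyMinimal] {C : VariableChange ℚ}
    (hC : C • curve144a1.quadraticTwist D = W) (hr : W.analyticRank = 1) : CornerF W 2 :=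
  CornerFTwo.cornerF_two_iff.mpr ⟨(hasCM_and_cmInert_two_of_smul_twist_curve144a1 hD hC).1, hr⟩

end Summit.BirchSwinnertonDyer.Rank1Residual.P2

end
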